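import Mathlib
import Literature.Probability.Process.ExtendedContinuousMapping
import HarnessLib

/-!
# Conditional laws pass to weak limits under continuous convergence of the kernels

Crux `AxiomsOfLimit` (stmt-CriticalPhenomena-1370), line `registered` (= `split`), stub `stub_markovOfLimit`:
CONTINUUM HALF of the Markov passage, part 2 (lead c3). Generic weak-convergence tool (theorems only).

Setting: probability spaces `(Ωs n, P n)` carrying pairs `(X n, Y n)` with values in `A × B` (think: the lattice
past `stopAt F` and future `startFrom F` of the critical SAW polyline at mesh `δ_n`), whose conditional law of
`Y n` given `X n = x` is a kernel `κs n x` (on the lattice: the critical chord law of the slit graph, an EXACT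
identity, tree `…ExcursionDomination.law_prefix_restrict`), and a limit pair `(X₀, Y₀)` under `μ` with a candidate
kernel `κ` (the future kernel of the limit). If

* `(X n, Y n) → (X₀, Y₀)` in law (bounded continuous test functions on `A × B`);
* the kernels converge CONTINUOUSLY along good points: for `μ ∘ X₀⁻¹`-a.e. `x`, whenever `xs j ∈ K (u j)` (good
  sets of full `P (u j) ∘ (X (u j))⁻¹`-measure, e.g. the charged lattice pasts) and `xs j → x`, then
  `∫ g dκs (u j) (xs j) → ∫ g dκ x` for every bounded continuous `g` ("tip stability");
* the kernels are sub-probability measures;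

then the tensor identity `∫ f(X n) g(Y n) dP n = ∫ f(X n) (∫ g dκs n (X n)) dP n` passes to the limit:
`∫ f(X₀) g(Y₀) dμ = ∫ f(X₀) (∫ g dκ(X₀)) dμ` (`integral_mul_eq_integral_mul_integral_kernel_of_tendsto`), which is
exactly the hypothesis of `AxiomsOfLimitMarkov.markov_clause_of_forall_integral` (part 1). The engine is the
tree's extended almost-continuous mapping theorem (`Literature.Probability.Process.ExtendedContinuousMapping`,
Billingsley 1999 Thm 2.7 / van der Vaart–Wellner 1996 Thm 1.11.1) applied to the maps
`x ↦ f x · ∫ g dκs n x`, plus convergence of means of uniformly bounded variables converging in law.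

References: P. Billingsley, *Convergence of Probability Measures*, 2nd ed. (1999), Thm 2.7 and §"maps varying
with n"; A. W. van der Vaart, J. A. Wellner, *Weak Convergence and Empirical Processes* (1996), Thm 1.11.1;
O. Kallenberg, *Foundations of Modern Probability*, 2nd ed. (2002), Thm 4.27 (convergence of means under uniform
integrability). All [folklore].
-/

noncomputable section

open MeasureTheory ProbabilityTheory Filter Topology Set BoundedContinuousFunction
open scoped NNReal ENNReal

namespace Summit.CriticalPhenomena.SAWScalingLimit.Theorems.AxiomsOfLimitMarkov

/-! ### Two elementary facts on bounded continuous test functions -/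

/-- A bounded continuous real function agreeing with the identity on `[-M, M]` (truncation). [folklore] -/
theorem exists_bcf_eq_self_of_abs_le {M : ℝ} (hM : 0 ≤ M) :
    ∃ τ : ℝ →ᵇ ℝ, ∀ r : ℝ, |r| ≤ M → τ r = r := by
  refine ⟨BoundedContinuousFunction.mkOfBound ⟨fun r => max (-M) (min M r), by fun_prop⟩ (2 * M) ?_, ?_⟩
  · intro x y
    simp only [ContinuousMap.coe_mk, Real.dist_eq]
    have h1 : -M ≤ max (-M) (min M x) := le_max_left _ _
    have h2 : max (-M) (min M x) ≤ M := max_le (by linarith) (min_le_left _ _)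
    have h3 : -M ≤ max (-M) (min M y) := le_max_left _ _
    have h4 : max (-M) (min M y) ≤ M := max_le (by linarith) (min_le_left _ _)
    rw [abs_le]; constructor <;> linarith
  · intro r hr
    rw [abs_le] at hr
    simp only [BoundedContinuousFunction.mkOfBound_coe, ContinuousMap.coe_mk]
    rw [min_eq_right hr.2, max_eq_right hr.1]

/-- The integral of a bounded continuous `g` against a sub-probability measure is bounded by `‖g‖`. [folklore] -/
theorem abs_integral_bcf_le_norm {B : Type*} [MeasurableSpace B] [TopologicalSpace B] (ν : Measure B)
    (hν : ν univ ≤ 1) (g : B →ᵇ ℝ) : |∫ b, g b ∂ν| ≤ ‖g‖ := by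
  haveI : IsFiniteMeasure ν := ⟨hν.trans_lt ENNReal.one_lt_top⟩
  have hreal : ν.real univ ≤ 1 := by
    have := ENNReal.toReal_mono ENNReal.one_ne_top hν
    simpa [Measure.real] using this
  calc |∫ b, g b ∂ν| ≤ ∫ b, |g b| ∂ν := abs_integral_le_integral_abs
    _ ≤ ∫ _, ‖g‖ ∂ν := by
        refine integral_mono_of_nonneg (Eventually.of_forall fun b => abs_nonneg _) (integrable_const _)
          (Eventually.of_forall fun b => ?_)
        show |g b| ≤ ‖g‖
        rw [← Real.norm_eq_abs]
        exact g.norm_coe_le_norm b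
    _ = ‖g‖ * ν.real univ := by rw [integral_const, smul_eq_mul, mul_comm]
    _ ≤ ‖g‖ * 1 := mul_le_mul_of_nonneg_left hreal (norm_nonneg _)
    _ = ‖g‖ := mul_one _

/-! ### Convergence of means of uniformly bounded variables converging in law -/

section Means

variable {Ωs : ℕ → Type*} {mΩ : ∀ n, MeasurableSpace (Ωs n)} {P : ∀ n, Measure (Ωs n)}
  [∀ n, IsProbabilityMeasure (P n)] {Ω : Type*} {mΩ' : MeasurableSpace Ω} {μ : Measure Ω}
  [IsProbabilityMeasure μ]

/-- **Means converge when uniformly bounded real variables converge in law** (test the truncation at the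
uniform bound, a bounded continuous function agreeing with the identity on the range). [folklore] -/
theorem tendsto_integral_of_tendstoInDistribution_of_abs_le {W : ∀ n, Ωs n → ℝ} {W₀ : Ω → ℝ}
    (h : TendstoInDistribution W atTop W₀ P μ) {M : ℝ} (hM : 0 ≤ M) (hW : ∀ n ω, |W n ω| ≤ M)
    (hW₀ : ∀ ω, |W₀ ω| ≤ M) :
    Tendsto (fun n => ∫ ω, W n ω ∂P n) atTop (𝓝 (∫ ω, W₀ ω ∂μ)) := by
  obtain ⟨τ, hτ⟩ := exists_bcf_eq_self_of_abs_le hM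
  have key := (ProbabilityMeasure.tendsto_iff_forall_integral_tendsto.1 h.tendsto) τ
  simp only [ProbabilityMeasure.coe_mk] at key
  have hn : ∀ n, ∫ x, τ x ∂((P n).map (W n)) = ∫ ω, W n ω ∂P n := fun n => by
    rw [integral_map (h.forall_aemeasurable n) τ.continuous.aestronglyMeasurable]
    exact integral_congr_ae (Eventually.of_forall fun ω => hτ _ (hW n ω))
  have h0 : ∫ x, τ x ∂(μ.map W₀) = ∫ ω, W₀ ω ∂μ := by
    rw [integral_map h.aemeasurable_limit τ.continuous.aestronglyMeasurable]
    exact integral_congr_ae (Eventually.of_forall fun ω => hτ _ (hW₀ ω))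
  simp_rw [hn, h0] at key
  exact key

end Means

/-! ### The kernel passage theorem -/

section Passage

variable {A B : Type*} [MeasurableSpace A] [PseudoEMetricSpace A] [OpensMeasurableSpace A]
  [MeasurableSpace B] [TopologicalSpace B] [OpensMeasurableSpace B]
  {Ωs : ℕ → Type*} {mΩ : ∀ n, MeasurableSpace (Ωs n)} {P : ∀ n, Measure (Ωs n)}
  [∀ n, IsProbabilityMeasure (P n)] {Ω : Type*} {mΩ' : MeasurableSpace Ω} {μ : Measure Ω}
  [IsProbabilityMeasure μ] {X : ∀ n, Ωs n → A} {Y : ∀ n, Ωs n → B} {X₀ : Ω → A} {Y₀ : Ω → B}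

omit [MeasurableSpace A] [OpensMeasurableSpace A] [MeasurableSpace B] [OpensMeasurableSpace B]
  [∀ n, IsProbabilityMeasure (P n)] [IsProbabilityMeasure μ] in
/-- Convergence in law of the pairs, tested against bounded continuous functions of the first coordinate.
[folklore] -/
theorem tendsto_integral_fst_of_tendsto_integral_pair
    (hXY : ∀ φ : A × B →ᵇ ℝ,
      Tendsto (fun n => ∫ ω, φ (X n ω, Y n ω) ∂P n) atTop (𝓝 (∫ ω, φ (X₀ ω, Y₀ ω) ∂μ)))
    (f : A →ᵇ ℝ) :
    Tendsto (fun n => ∫ ω, f (X n ω) ∂P n) atTop (𝓝 (∫ ω, f (X₀ ω) ∂μ)) := by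
  have := hXY (f.compContinuous ContinuousMap.fst)
  simpa only [compContinuous_apply, ContinuousMap.fst_apply] using this

omit [MeasurableSpace B] [OpensMeasurableSpace B] in
/-- From test-function convergence of the first coordinates to `TendstoInDistribution`. [folklore] -/
theorem tendstoInDistribution_of_tendsto_integral (hX : ∀ n, AEMeasurable (X n) (P n))
    (hX₀ : AEMeasurable X₀ μ)
    (hlim : ∀ f : A →ᵇ ℝ, Tendsto (fun n => ∫ ω, f (X n ω) ∂P n) atTop (𝓝 (∫ ω, f (X₀ ω) ∂μ))) :
    TendstoInDistribution X atTop X₀ P μ where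
  forall_aemeasurable := hX
  aemeasurable_limit := hX₀
  tendsto := by
    rw [ProbabilityMeasure.tendsto_iff_forall_integral_tendsto]
    intro f
    simp only [ProbabilityMeasure.coe_mk]
    have hn : ∀ n, ∫ x, f x ∂((P n).map (X n)) = ∫ ω, f (X n ω) ∂P n := fun n =>
      integral_map (hX n) f.continuous.aestronglyMeasurable
    have h0 : ∫ x, f x ∂(μ.map X₀) = ∫ ω, f (X₀ ω) ∂μ :=
      integral_map hX₀ f.continuous.aestronglyMeasurable
    simp_rw [hn, h0]
    exact hlim f

/-- **Means of `f(X n) · ∫ g dκs n (X n)` converge** when `X n → X₀` in law and the kernels converge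
continuously along good points (extended almost-continuous mapping theorem applied to the uniformly bounded
maps `x ↦ f x · ∫ g dκs n x`). [folklore] -/
theorem tendsto_integral_mul_integral_kernel (hX : ∀ n, Measurable (X n)) (hX₀ : Measurable X₀)
    (hlim : ∀ f : A →ᵇ ℝ, Tendsto (fun n => ∫ ω, f (X n ω) ∂P n) atTop (𝓝 (∫ ω, f (X₀ ω) ∂μ)))
    (κs : ℕ → Kernel A B) (κ : Kernel A B) (hκs : ∀ n a, κs n a univ ≤ 1) (hκ : ∀ a, κ a univ ≤ 1)
    {K : ℕ → Set A} (hKm : ∀ n, MeasurableSet (K n)) (hK : ∀ n, ∀ᵐ ω ∂P n, X n ω ∈ K n)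
    (g : B →ᵇ ℝ)
    (hcont : ∀ᵐ x ∂(μ.map X₀), ∀ u : ℕ → ℕ, StrictMono u → ∀ xs : ℕ → A,
      (∀ j, xs j ∈ K (u j)) → Tendsto xs atTop (𝓝 x) →
        Tendsto (fun j => ∫ b, g b ∂(κs (u j) (xs j))) atTop (𝓝 (∫ b, g b ∂(κ x))))
    (f : A →ᵇ ℝ) :
    Tendsto (fun n => ∫ ω, f (X n ω) * (∫ b, g b ∂(κs n (X n ω))) ∂P n) atTop
      (𝓝 (∫ ω, f (X₀ ω) * (∫ b, g b ∂(κ (X₀ ω))) ∂μ)) := by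
  have hTD : TendstoInDistribution X atTop X₀ P μ :=
    tendstoInDistribution_of_tendsto_integral (fun n => (hX n).aemeasurable) hX₀.aemeasurable hlim
  -- the varying maps `ψs n x = f x · ∫ g dκs n x` and their limit
  set ψs : ℕ → A → ℝ := fun n x => f x * ∫ b, g b ∂(κs n x) with hψs_def
  set ψ : A → ℝ := fun x => f x * ∫ b, g b ∂(κ x) with hψ_def
  have hmeas_int : ∀ (η : Kernel A B), Measurable fun x : A => ∫ b, g b ∂(η x) := fun η =>
    (g.continuous.stronglyMeasurable.integral_kernel (κ := η)).measurable
  have hψs_m : ∀ n, Measurable (ψs n) := fun n => f.continuous.measurable.mul (hmeas_int (κs n))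
  have hψ_m : Measurable ψ := f.continuous.measurable.mul (hmeas_int κ)
  have hcomp : TendstoInDistribution (fun n => ψs n ∘ X n) atTop (ψ ∘ X₀) P μ := by
    refine Literature.Probability.Process.tendstoInDistribution_comp_of_forall_exists_seq_tendsto
      (F' := ℝ) hTD hψs_m hψ_m fun ε _ => ⟨K, hKm, Eventually.of_forall fun n => ?_, ?_⟩
    · have h0 : P n (X n ⁻¹' (K n)ᶜ) = 0 := ae_iff.1 (hK n)
      rw [h0]; exact bot_le
    · filter_upwards [hcont] with x hx u hu xs hxs hxlim
      exact ((f.continuous.tendsto x).comp hxlim).mul (hx u hu xs hxs hxlim)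
  -- uniform bound `‖f‖ · ‖g‖`
  have hbd : ∀ (η : Kernel A B), (∀ a, η a univ ≤ 1) → ∀ x, |f x * ∫ b, g b ∂(η x)| ≤ ‖f‖ * ‖g‖ := by
    intro η hη x
    rw [abs_mul]
    refine mul_le_mul ?_ (abs_integral_bcf_le_norm _ (hη x) g) (abs_nonneg _) (norm_nonneg _)
    rw [← Real.norm_eq_abs]; exact f.norm_coe_le_norm x
  exact tendsto_integral_of_tendstoInDistribution_of_abs_le hcomp (by positivity)
    (fun n ω => hbd (κs n) (hκs n) (X n ω)) (fun ω => hbd κ hκ (X₀ ω))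

/-- **Kernel passage theorem: the tensor (disintegration) identity passes to weak limits under continuous
convergence of the kernels.** Let `(X n, Y n) → (X₀, Y₀)` in law (bounded continuous test functions on `A × B`),
let `κs n` be sub-probability kernels disintegrating `Y n` given `X n` in tensor form,
`∫ f(X n) g(Y n) dP n = ∫ f(X n) (∫ g dκs n (X n)) dP n`, carried by measurable good sets `K n ∋ X n` a.s., and let
`κ` be a sub-probability kernel such that for `μ ∘ X₀⁻¹`-a.e. `x` the kernels converge continuously along good
sequences: `xs j ∈ K (u j)`, `xs j → x` ⟹ `∫ g dκs (u j) (xs j) → ∫ g dκ x`. Then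
`∫ f(X₀) g(Y₀) dμ = ∫ f(X₀) (∫ g dκ(X₀)) dμ`. With `X = stopAt F`, `Y = startFrom F` of the lattice curve and of
the limit, this is the hypothesis of `markov_clause_of_forall_integral` (part 1), so the `markov` clause of
`ChordalFamily.IsMarkovExtension` at `(D, F)` follows (Billingsley 1999 Thm 2.7; Kallenberg 2002 Thm 6.3).
[folklore] -/
theorem integral_mul_eq_integral_mul_integral_kernel_of_tendsto (hX : ∀ n, Measurable (X n))
    (hX₀ : Measurable X₀)
    (hXY : ∀ φ : A × B →ᵇ ℝ,
      Tendsto (fun n => ∫ ω, φ (X n ω, Y n ω) ∂P n) atTop (𝓝 (∫ ω, φ (X₀ ω, Y₀ ω) ∂μ)))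
    (κs : ℕ → Kernel A B) (κ : Kernel A B) (hκs : ∀ n a, κs n a univ ≤ 1) (hκ : ∀ a, κ a univ ≤ 1)
    {K : ℕ → Set A} (hKm : ∀ n, MeasurableSet (K n)) (hK : ∀ n, ∀ᵐ ω ∂P n, X n ω ∈ K n)
    {f : A →ᵇ ℝ} {g : B →ᵇ ℝ}
    (hcont : ∀ᵐ x ∂(μ.map X₀), ∀ u : ℕ → ℕ, StrictMono u → ∀ xs : ℕ → A,
      (∀ j, xs j ∈ K (u j)) → Tendsto xs atTop (𝓝 x) →
        Tendsto (fun j => ∫ b, g b ∂(κs (u j) (xs j))) atTop (𝓝 (∫ b, g b ∂(κ x))))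
    (hident : ∀ n, ∫ ω, f (X n ω) * g (Y n ω) ∂P n = ∫ ω, f (X n ω) * (∫ b, g b ∂(κs n (X n ω))) ∂P n) :
    ∫ ω, f (X₀ ω) * g (Y₀ ω) ∂μ = ∫ ω, f (X₀ ω) * (∫ b, g b ∂(κ (X₀ ω))) ∂μ := by
  -- left-hand sides converge by joint convergence in law (tensor test function)
  have hL : Tendsto (fun n => ∫ ω, f (X n ω) * g (Y n ω) ∂P n) atTop
      (𝓝 (∫ ω, f (X₀ ω) * g (Y₀ ω) ∂μ)) := by
    have := hXY (f.compContinuous ContinuousMap.fst * g.compContinuous ContinuousMap.snd)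
    simpa only [BoundedContinuousFunction.coe_mul, Pi.mul_apply, compContinuous_apply,
      ContinuousMap.fst_apply, ContinuousMap.snd_apply] using this
  -- right-hand sides converge by the extended continuous mapping theorem
  have hR := tendsto_integral_mul_integral_kernel hX hX₀ (tendsto_integral_fst_of_tendsto_integral_pair hXY)
    κs κ hκs hκ hKm hK g hcont f
  exact tendsto_nhds_unique hL (hR.congr' (Eventually.of_forall fun n => (hident n).symm))


/-! ### Registered sub-goal of crux stmt-CriticalPhenomena-1370 (line `registered`, stub `stub_markovOfLimit`) -/

/-- **Registered sub-goal `stub_kernelPassage`** (crux stmt-CriticalPhenomena-1370, continuum half of the Markov passage,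
part 2): the kernel passage theorem with all binders explicit and notation-free, at universe level `0` (the level of
`SAW.DomainSAW … ` and `CurveClass ℂ`) (`= integral_mul_eq_integral_mul_integral_kernel_of_tendsto`). [folklore] -/
theorem stub_kernelPassage :
    ∀ (A B : Type) [MeasurableSpace A] [PseudoEMetricSpace A] [OpensMeasurableSpace A] [MeasurableSpace B] [TopologicalSpace B] [OpensMeasurableSpace B] (Ωs : ℕ → Type) [∀ n, MeasurableSpace (Ωs n)] (P : ∀ n, MeasureTheory.Measure (Ωs n)) [∀ n, MeasureTheory.IsProbabilityMeasure (P n)] (Ω : Type) [MeasurableSpace Ω] (μ : MeasureTheory.Measure Ω) [MeasureTheory.IsProbabilityMeasure μ] (X : ∀ n, Ωs n → A) (Y : ∀ n, Ωs n → B) (X₀ : Ω → A) (Y₀ : Ω → B), (∀ n, Measurable (X n)) → Measurable X₀ → (∀ φ : BoundedContinuousFunction (A × B) ℝ, Filter.Tendsto (fun n => MeasureTheory.integral (P n) (fun ω => φ (X n ω, Y n ω))) Filter.atTop (nhds (MeasureTheory.integral μ (fun ω => φ (X₀ ω, Y₀ ω))))) → ∀ (κs : ℕ → ProbabilityTheory.Kernel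 A B) (κ : ProbabilityTheory.Kernel A B), (∀ n a, κs n a Set.univ ≤ 1) → (∀ a, κ a Set.univ ≤ 1) → ∀ (K : ℕ → Set A), (∀ n, MeasurableSet (K n)) → (∀ n, Filter.Eventually (fun ω => X n ω ∈ K n) (MeasureTheory.ae (P n))) → ∀ (f : BoundedContinuousFunction A ℝ) (g : BoundedContinuousFunction B ℝ), Filter.Eventually (fun x => ∀ u : ℕ → ℕ, StrictMono u → ∀ xs : ℕ → A, (∀ j, xs j ∈ K (u j)) → Filter.Tendsto xs Filter.atTop (nhds x) → Filter.Tendsto (fun j => MeasureTheory.integral (κs (u j) (xs j)) (fun b => g b)) Filter.atTop (nhds (MeasureTheory.integral (κ x) (fun b => g b)))) (MeasureTheory.ae (μ.map X₀)) → (∀ n, MeasureTheory.integral (P n) (fun ω => f (X n ω) * g (Y n ω)) = MeasureTheory.integral (P n) (fun ω => f (X n ω) * MeasureTheory.integral (κs n (X n ω)) (fun b => g b))) → MeasureTheory.integral μ (fun ω => f (X₀ ω) * g (Y₀ ω)) = MeasureTheory.integral μ (fun ω => f (X₀ ω) * MeasureTheory.integral (κ (X₀ ω)) (fun b => g b)) 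:=
  fun _ _ _ _ _ _ _ _ _ _ _ _ _ _ _ _ _ _ _ _ hX hX₀ hXY κs κ hκs hκ _ hKm hK _ _ hcont hident =>
    integral_mul_eq_integral_mul_integral_kernel_of_tendsto hX hX₀ hXY κs κ hκs hκ hKm hK hcont hident

end Passage

end Summit.CriticalPhenomena.SAWScalingLimit.Theorems.AxiomsOfLimitMarkov

end
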